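import Literature.Algebra.Lie.LefschetzModuleHodgeInvolution
import HarnessLib

/-!
# `L`, `*_L`, `*_H` and `ᶜΛ` are self-adjoint for a Poincaré-type pairing (André 1996, §1.1 remark and Prop. 1.2, last clause)

Topic `Literature/Algebra/Lie` (namespace `Literature.Algebra.Lie`).  Lane `lit-hodgefound` (Track 2 foundations library),
prover seat `lit-hodgefound-p34` (generation 30, row g30-#3), a sequel of `LefschetzModule.lean` (row A1-88 of seat
`lit-hodgefound-skel-1`: `degreeSpace`, `IsZGrading`, `HasLefschetzProperty`, `primitiveSpace`, the partner `f = ᶜΛ = dual`, §9 the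
infinitesimally INVARIANT forms of Looijenga–Lunts (1.3): `h`, `e` SKEW ⟹ `f` skew), `LefschetzModuleStringReversal.lean` (strings span,
`linearMap_ext_of_strings`), `LefschetzModuleLefschetzInvolution.lean` (`*_L = lefschetzInvolution`) and `LefschetzModuleHodgeInvolution.lean`
(`*_H = hodgeInvolution`).  Here the bilinear form is of POINCARÉ type — `h` skew-adjoint (the pairing matches complementary degrees)
and `e = L` SELF-adjoint (`∫ Lx ∪ y = ∫ x ∪ Ly`) — and the conclusion is André's remark that `*_L`, `*_H`, `ᶜΛ` are then
self-adjoint too, together with the last clause of his Prop. 1.2 (`L` and `*_L L *_L` are adjoint for `(x, y) ↦ ∫ x ∪ * y`).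
PROVED theorems only (no definition, no named fact, no `sorry`, no instance, no notation; net debt `0`).  No non-degeneracy and
no `𝔰𝔩₂`-uniqueness is used: everything is checked on the strings `p, e p, …, eᵏ p`, which span.

## Source, VERBATIM

Y. André, *Pour une théorie inconditionnelle des motifs*, Publ. Math. IHÉS **83** (1996) [Andre1996Motifs] (held
`paper:doi-10-1007-bf02698643`), §1.1 (p. 11 = p0008 L11–L14): "On voit immédiatement que `Pʲ(X) = Hʲ(X) ∩ Ker *_L L *_L` et que
l'opérateur `*_L L *_L = *_H L *_H`, proportionnel à `ᶜΛ` sur chaque composante de Lefschetz, est un inverse à droite de `L` sur l'image de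
`L`. Remarquons aussi que `L`, `*_L`, `*_H` et `ᶜΛ` sont auto-adjoints relativement à l'accouplement de dualité de Poincaré
`(x, y) ↦ ∫ x ∪ y`."; Prop. 1.2 (p. 11 = p0008 L62–L66): "[…] Via cet isomorphisme, la transposition relative à la forme bilinéaire
`(x, y) ↦ ∫ x ∪ * y` correspond à la transposition des matrices, pour `* = *_L` ou `*_H`."; proof (p. 12 = p0009 L13–L15): "Quant à
la dernière assertion, il suffit de la tester sur les générateurs `L` et `*_L L *_L`. Comme ces générateurs s'échangent par la
transposition, c'est clair."

## Rendering (dictionary, continuing the files above)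

* "l'accouplement de dualité de Poincaré": a bilinear form `B : M →ₗ M →ₗ K` on the graded `(M, h)` for which `h` is SKEW-adjoint
  (`B.IsSkewAdjoint h`: then `B(M_k, M_l) = 0` unless `k + l = 0`, A1-88 `apply_eq_zero_of_isSkewAdjoint_of_mem_degreeSpace` — the
  pairing of `Hʲ` with `H^{2d-j}`) and `e = L` is SELF-adjoint (`B.IsSelfAdjoint e`: `∫ ω ∧ x ∧ y = ∫ x ∧ ω ∧ y`).  No symmetry and
  no non-degeneracy of `B` is assumed.
* "auto-adjoint": Mathlib's `LinearMap.IsSelfAdjoint B u` (`B (u x) y = B x (u y)`); "la transposition relative à `(x, y) ↦ ∫ x ∪ * y`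
  […] `L` et `*_L L *_L` s'échangent": `LinearMap.IsAdjointPair B⋆ B⋆ e (s e s)` and `… (s e s) e` for the twisted form
  `B⋆ = B.compl₂ s`, `B⋆ x y = B x (s y)`, `s = *_L` or `*_H`.

## Contents (all proved; `L : HasLefschetzProperty h e`, `hgr : IsZGrading h`, `hh : B.IsSkewAdjoint h`, `he : B.IsSelfAdjoint e`)

* §1 strings are `B`-orthogonal unless matched: `isSelfAdjoint_pow` (`eⁱ` self-adjoint), `apply_pow_primitive_pow_primitive_eq_zero`
  (`B(eⁱ p, eⁱ' p') = 0` for `p ∈ P_{-k}`, `p' ∈ P_{-k'}` unless `k = k'` and `i + i' = k`),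
  `apply_pow_primitive_pow_primitive_eq` (`= B(eᵏ p, p')` in the matched case).
* §2 André's remark: **`isSelfAdjoint_lefschetzInvolution`** (`*_L`), **`isSelfAdjoint_hodgeInvolution`** (`*_H`),
  **`isSelfAdjoint_dual`** (`ᶜΛ`), `isSelfAdjoint_conj_lefschetzInvolution` (`*_L L *_L`), `isSelfAdjoint_conj_hodgeInvolution`;
  for any string reversal: `IsStringReversal.isSelfAdjoint`.
* §3 Prop. 1.2, last clause: **`isAdjointPair_compl₂_lefschetzInvolution`** / `isAdjointPair_compl₂_lefschetzInvolution'`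
  (`e` and `*_L e *_L` are mutually adjoint for `B⋆ = B(·, *_L ·)`), `isAdjointPair_compl₂_hodgeInvolution` / `…'` (same for `*_H`).
* §4 consequences: `exists_isAdjointPair_of_mem_adjoin` (a subalgebra generated by self-adjoint operators is stable under adjoints —
  generic), **`exists_isAdjointPair_of_mem_adjoin_pair_dual`** (`K[e, ᶜΛ]` is stable under transposition for `B`).

The concrete singular-cohomology and Kähler carriers (`HodgeTheory/…`, `Geometry/Kaehler/…`) and skel-1's INVARIANT-form series
(`LefschetzModuleInvariantForm`, `LefschetzStringInvariantForm`, `LefschetzInvariantFormParity`: `e` skew) are different statements,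
announced BY NAME only; nothing restated, nothing imported beyond the files above.

## References

* [Andre1996Motifs] Y. André, *Pour une théorie inconditionnelle des motifs*, Publ. Math. IHÉS 83 (1996) 5–49, §1.1 (p. 11), Prop. 1.2
  (pp. 11–12).
* [Kleiman1968AlgebraicCycles] S. L. Kleiman, *Algebraic cycles and the Weil conjectures* (1968), §1.4 (1.4.2–1.4.5) — via André.
* [LooijengaLunts1997] E. Looijenga, V. A. Lunts, *A Lie algebra attached to a projective variety*, Invent. Math. 129 (1997), §1 (1.3).
-/

noncomputable section

namespace Literature.Algebra.Lie

open Module Function Set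
open LinearMap (BilinForm)
open HasLefschetzProperty (primitiveSpace mem_primitiveSpace_iff)

variable {K : Type*} [Field K] [CharZero K] {M : Type*} [AddCommGroup M] [Module K M]
  {B : BilinForm K M} {h e : Module.End K M}

/-! ### §1 Strings are `B`-orthogonal unless their lengths and positions match -/

omit [CharZero K] in
/-- Powers of a self-adjoint operator are self-adjoint: `B(eⁱ x, y) = B(x, eⁱ y)`. [cite: Andre1996Motifs, §1.1 (p. 11, "L […] auto-adjoint")] -/
theorem isSelfAdjoint_pow (he : B.IsSelfAdjoint e) (i : ℕ) : B.IsSelfAdjoint ⇑(e ^ i) := by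
  induction i with
  | zero => rw [pow_zero]; exact LinearMap.isAdjointPair_one
  | succ i ih =>
    have h1 : LinearMap.IsAdjointPair B B (⇑(e ^ i * e)) (⇑(e * e ^ i)) := LinearMap.IsAdjointPair.mul ih he
    rw [← pow_succ, ← pow_succ'] at h1
    exact h1

/-- **Two string vectors pair to zero unless the strings have the same length and the positions are complementary**: for
`p ∈ P_{-k}`, `p' ∈ P_{-k'}`, `i ≤ k`, `i' ≤ k'`, `B(eⁱ p, eⁱ' p') ≠ 0` forces `k = k'` and `i + i' = k` (degrees: `B(M_a, M_b) = 0`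
unless `a + b = 0`, so `2(i + i') = k + k'`; then `B(eⁱ p, eⁱ' p') = B(e^{i+i'} p, p') = B(p, e^{i+i'} p')` and the shorter string is
exhausted). [cite: Andre1996Motifs, §1.1 (p. 11)] -/
theorem apply_pow_primitive_pow_primitive_eq_zero (L : HasLefschetzProperty h e) (hh : B.IsSkewAdjoint h) (he : B.IsSelfAdjoint e)
    {k k' i i' : ℕ} {p p' : M} (hp : p ∈ primitiveSpace h e k) (hp' : p' ∈ primitiveSpace h e k')
    (hne : ¬(k = k' ∧ i + i' = k)) : B ((e ^ i) p) ((e ^ i') p') = 0 := by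
  have hpk := (mem_primitiveSpace_iff.1 hp).1
  have hpk' := (mem_primitiveSpace_iff.1 hp').1
  by_cases hdeg : (-(k : ℤ) + 2 * (i : ℕ)) + (-(k' : ℤ) + 2 * (i' : ℕ)) = 0
  · -- degrees match: `2(i + i') = k + k'`; move all the `e`'s to one side
    have h1 : B ((e ^ i) p) ((e ^ i') p') = B ((e ^ i') ((e ^ i) p)) p' := (isSelfAdjoint_pow he i' _ _).symm
    have h2 : B ((e ^ i) p) ((e ^ i') p') = B p ((e ^ i) ((e ^ i') p')) := isSelfAdjoint_pow he i _ _
    rcases lt_trichotomy k k' with hkk | rfl | hkk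
    · rw [h1, pow_apply_pow_primitive_of_lt hp (i := i') (j := i) (by omega), map_zero, LinearMap.zero_apply]
    · exact absurd ⟨rfl, by omega⟩ hne
    · rw [h2, pow_apply_pow_primitive_of_lt hp' (i := i) (j := i') (by omega), map_zero]
  · exact apply_eq_zero_of_isSkewAdjoint_of_mem_degreeSpace hh hdeg (L.pow_apply_mem hpk i) (L.pow_apply_mem hpk' i')

omit [CharZero K] in
/-- In the matched case the pairing of two string vectors is the pairing of a top with a bottom: for `p, p' ∈ P_{-k}` and
`i + i' = k`, `B(eⁱ p, eⁱ' p') = B(eᵏ p, p')`. [cite: Andre1996Motifs, §1.1 (p. 11)] -/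
theorem apply_pow_primitive_pow_primitive_eq (he : B.IsSelfAdjoint e) {k i i' : ℕ} (hii : i + i' = k) (p p' : M) :
    B ((e ^ i) p) ((e ^ i') p') = B ((e ^ k) p) p' := by
  rw [← (isSelfAdjoint_pow he i' ((e ^ i) p) p'), ← Module.End.mul_apply, ← pow_add, hii.symm, add_comm]

/-! ### §2 André's remark: `*_L`, `*_H`, `ᶜΛ` are self-adjoint -/

section SelfAdjoint

variable [FiniteDimensional K M]

/-- **A criterion on strings**: two operators `S`, `T` are mutually adjoint for `B` as soon as
`B(S (eʲ p), eʲ' p') = B(eʲ p, T (eʲ' p'))` for all string vectors (the strings span `M`). [cite: Andre1996Motifs, §1.1 (p. 10, operators defined on the Lefschetz decomposition)] -/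
theorem isAdjointPair_of_strings (L : HasLefschetzProperty h e) (hgr : IsZGrading h) {S T : Module.End K M}
    (hST : ∀ ⦃k : ℕ⦄ ⦃p : M⦄, p ∈ primitiveSpace h e k → ∀ ⦃j : ℕ⦄, j ≤ k →
      ∀ ⦃k' : ℕ⦄ ⦃p' : M⦄, p' ∈ primitiveSpace h e k' → ∀ ⦃j' : ℕ⦄, j' ≤ k' →
        B (S ((e ^ j) p)) ((e ^ j') p') = B ((e ^ j) p) (T ((e ^ j') p'))) :
    LinearMap.IsAdjointPair B B S T := by
  rw [LinearMap.isAdjointPair_iff_comp_eq_compl₂]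
  refine L.linearMap_ext_of_strings hgr fun k p hp j hj ↦ ?_
  refine L.linearMap_ext_of_strings hgr fun k' p' hp' j' hj' ↦ ?_
  rw [LinearMap.comp_apply, LinearMap.compl₂_apply]
  exact hST hp hj hp' hj'

/-- **"`*_L` […] auto-adjoint relativement à l'accouplement de dualité de Poincaré"**: for a pairing with `h` skew-adjoint and
`e` self-adjoint, `B(*_L x, y) = B(x, *_L y)` (on strings: both sides vanish unless the strings have equal length `k` and equal
position `j = j'`, and then both equal `B(eᵏ p, p')`). [cite: Andre1996Motifs, §1.1 (p. 11)] -/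
theorem HasLefschetzProperty.isSelfAdjoint_lefschetzInvolution (L : HasLefschetzProperty h e) (hgr : IsZGrading h)
    (hh : B.IsSkewAdjoint h) (he : B.IsSelfAdjoint e) : B.IsSelfAdjoint (L.lefschetzInvolution hgr) := by
  refine isAdjointPair_of_strings L hgr fun k p hp j hj k' p' hp' j' hj' ↦ ?_
  rw [L.isStringReversal_lefschetzInvolution hgr hp hj, L.isStringReversal_lefschetzInvolution hgr hp' hj']
  by_cases hm : k = k' ∧ j = j'
  · obtain ⟨rfl, rfl⟩ := hm
    rw [apply_pow_primitive_pow_primitive_eq he (show k - j + j = k by omega),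
      apply_pow_primitive_pow_primitive_eq he (show j + (k - j) = k by omega)]
  · rw [apply_pow_primitive_pow_primitive_eq_zero L hh he hp hp' (fun h' ↦ hm ⟨h'.1, by omega⟩),
      apply_pow_primitive_pow_primitive_eq_zero L hh he hp hp' (fun h' ↦ hm ⟨h'.1, by omega⟩)]

/-- Every string reversal is self-adjoint (it is `*_L`). [cite: Andre1996Motifs, §1.1 (p. 11)] -/
theorem IsStringReversal.isSelfAdjoint {s : Module.End K M} (hs : IsStringReversal h e s) (L : HasLefschetzProperty h e)
    (hgr : IsZGrading h) (hh : B.IsSkewAdjoint h) (he : B.IsSelfAdjoint e) : B.IsSelfAdjoint s := by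
  rw [hs.eq_lefschetzInvolution L hgr]
  exact L.isSelfAdjoint_lefschetzInvolution hgr hh he

/-- **"`*_H` […] auto-adjoint"**: `B(*_H x, y) = B(x, *_H y)` (on strings of equal length `k` the two signs
`(-1)^{(d-k)(d-k+1)/2}` agree; strings of different lengths are orthogonal). [cite: Andre1996Motifs, §1.1 (p. 11)] -/
theorem HasLefschetzProperty.isSelfAdjoint_hodgeInvolution (L : HasLefschetzProperty h e) (hgr : IsZGrading h) (d : ℕ)
    (hh : B.IsSkewAdjoint h) (he : B.IsSelfAdjoint e) : B.IsSelfAdjoint (L.hodgeInvolution hgr d) := by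
  refine isAdjointPair_of_strings L hgr fun k p hp j hj k' p' hp' j' hj' ↦ ?_
  rw [L.hodgeInvolution_apply_pow_primitive hgr d hp hj, L.hodgeInvolution_apply_pow_primitive hgr d hp' hj', map_smul,
    LinearMap.smul_apply, map_smul, smul_eq_mul, smul_eq_mul]
  by_cases hm : k = k' ∧ j = j'
  · obtain ⟨rfl, rfl⟩ := hm
    rw [apply_pow_primitive_pow_primitive_eq he (show k - j + j = k by omega),
      apply_pow_primitive_pow_primitive_eq he (show j + (k - j) = k by omega)]
  · rw [apply_pow_primitive_pow_primitive_eq_zero L hh he hp hp' (fun h' ↦ hm ⟨h'.1, by omega⟩),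
      apply_pow_primitive_pow_primitive_eq_zero L hh he hp hp' (fun h' ↦ hm ⟨h'.1, by omega⟩), mul_zero, mul_zero]

/-- **"`ᶜΛ` […] auto-adjoint"**: `B(ᶜΛ x, y) = B(x, ᶜΛ y)` — on strings, by André's formula `ᶜΛ(e^{j+1} p) = (j+1)(k-j) eʲ p`:
both sides vanish unless the strings have equal length `k` and `j + j' = k + 1`, and then the coefficients `j(k-j+1)` and
`j'(k-j'+1)` coincide. [cite: Andre1996Motifs, §1.1 (p. 11)] [cite: Kleiman1968AlgebraicCycles, §1.4, 1.4.6] -/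
theorem HasLefschetzProperty.isSelfAdjoint_dual (L : HasLefschetzProperty h e) (hgr : IsZGrading h)
    (hh : B.IsSkewAdjoint h) (he : B.IsSelfAdjoint e) : B.IsSelfAdjoint (L.dual hgr) := by
  refine isAdjointPair_of_strings L hgr fun k p hp j hj k' p' hp' j' hj' ↦ ?_
  rcases Nat.eq_zero_or_pos j with rfl | hj0 <;> rcases Nat.eq_zero_or_pos j' with rfl | hj0'
  · simp only [pow_zero, Module.End.one_apply, L.dual_apply_primitive hgr hp, L.dual_apply_primitive hgr hp', map_zero,
      LinearMap.zero_apply]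
  · obtain ⟨i', rfl⟩ : ∃ i', j' = i' + 1 := ⟨j' - 1, by omega⟩
    have h0 := apply_pow_primitive_pow_primitive_eq_zero L hh he (i := 0) (i' := i') hp hp' (fun h' ↦ by omega)
    rw [pow_zero, Module.End.one_apply] at h0
    simp only [pow_zero, Module.End.one_apply, L.dual_apply_primitive hgr hp, map_zero, LinearMap.zero_apply,
      L.dual_apply_pow_primitive hgr hp' i', map_smul, h0, smul_zero]
  · obtain ⟨i, rfl⟩ : ∃ i, j = i + 1 := ⟨j - 1, by omega⟩
    have h0 := apply_pow_primitive_pow_primitive_eq_zero L hh he (i := i) (i' := 0) hp hp' (fun h' ↦ by omega)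
    rw [pow_zero, Module.End.one_apply] at h0
    simp only [pow_zero, Module.End.one_apply, L.dual_apply_primitive hgr hp', map_zero, L.dual_apply_pow_primitive hgr hp i,
      map_smul, LinearMap.smul_apply, h0, smul_zero]
  · obtain ⟨i, rfl⟩ : ∃ i, j = i + 1 := ⟨j - 1, by omega⟩
    obtain ⟨i', rfl⟩ : ∃ i', j' = i' + 1 := ⟨j' - 1, by omega⟩
    rw [L.dual_apply_pow_primitive hgr hp i, L.dual_apply_pow_primitive hgr hp' i', map_smul, LinearMap.smul_apply, map_smul,
      smul_eq_mul, smul_eq_mul]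
    by_cases hm : k = k' ∧ i + i' + 1 = k
    · obtain ⟨rfl, hii⟩ := hm
      rw [apply_pow_primitive_pow_primitive_eq he (show i + (i' + 1) = k by omega),
        apply_pow_primitive_pow_primitive_eq he (show i + 1 + i' = k by omega)]
      congr 1
      push_cast
      have : (i' : K) = (k : K) - i - 1 := by
        rw [show (k : K) = ((i + i' + 1 : ℕ) : K) by rw [hii]]; push_cast; ring
      rw [this]
      ring
    · rw [apply_pow_primitive_pow_primitive_eq_zero L hh he hp hp' (fun h' ↦ hm ⟨h'.1, by omega⟩),
        apply_pow_primitive_pow_primitive_eq_zero L hh he hp hp' (fun h' ↦ hm ⟨h'.1, by omega⟩), mul_zero, mul_zero]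

/-- **"l'opérateur `*_L L *_L` […]" is self-adjoint** (product of self-adjoint `*_L`, `L`, `*_L` in palindromic order).
[cite: Andre1996Motifs, §1.1 (p. 11)] -/
theorem HasLefschetzProperty.isSelfAdjoint_conj_lefschetzInvolution (L : HasLefschetzProperty h e) (hgr : IsZGrading h)
    (hh : B.IsSkewAdjoint h) (he : B.IsSelfAdjoint e) :
    B.IsSelfAdjoint ⇑(L.lefschetzInvolution hgr * e * L.lefschetzInvolution hgr) := by
  have hs := L.isSelfAdjoint_lefschetzInvolution hgr hh he
  have h1 : LinearMap.IsAdjointPair B B (⇑(L.lefschetzInvolution hgr * e * L.lefschetzInvolution hgr))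
      (⇑(L.lefschetzInvolution hgr * (e * L.lefschetzInvolution hgr))) := (hs.mul he).mul hs
  rwa [← mul_assoc] at h1

/-- `*_H L *_H` is self-adjoint. [cite: Andre1996Motifs, §1.1 (p. 11)] -/
theorem HasLefschetzProperty.isSelfAdjoint_conj_hodgeInvolution (L : HasLefschetzProperty h e) (hgr : IsZGrading h) (d : ℕ)
    (hh : B.IsSkewAdjoint h) (he : B.IsSelfAdjoint e) :
    B.IsSelfAdjoint ⇑(L.hodgeInvolution hgr d * e * L.hodgeInvolution hgr d) := by
  have hs := L.isSelfAdjoint_hodgeInvolution hgr d hh he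
  have h1 : LinearMap.IsAdjointPair B B (⇑(L.hodgeInvolution hgr d * e * L.hodgeInvolution hgr d))
      (⇑(L.hodgeInvolution hgr d * (e * L.hodgeInvolution hgr d))) := (hs.mul he).mul hs
  rwa [← mul_assoc] at h1

/-! ### §3 Prop. 1.2, last clause: `L` and `* L *` are mutually adjoint for `(x, y) ↦ B(x, * y)` -/

omit [FiniteDimensional K M] in
/-- **"la transposition relative à la forme bilinéaire `(x, y) ↦ ∫ x ∪ *_L y` […] ces générateurs [`L`, `*_L L *_L`] s'échangent
par la transposition"**: `B(e x, *_L y) = B(x, *_L ((*_L e *_L) y))`. [cite: Andre1996Motifs, Prop. 1.2 (p. 11) and its proof (p. 12)] -/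
theorem HasLefschetzProperty.isAdjointPair_compl₂_lefschetzInvolution (L : HasLefschetzProperty h e) (hgr : IsZGrading h)
    (he : B.IsSelfAdjoint e) :
    LinearMap.IsAdjointPair (B.compl₂ (L.lefschetzInvolution hgr)) (B.compl₂ (L.lefschetzInvolution hgr)) ⇑e
      ⇑(L.lefschetzInvolution hgr * e * L.lefschetzInvolution hgr) := by
  intro x y
  rw [LinearMap.compl₂_apply, LinearMap.compl₂_apply, he, Module.End.mul_apply, Module.End.mul_apply,
    L.lefschetzInvolution_lefschetzInvolution hgr]

/-- … and symmetrically `B((*_L e *_L) x, *_L y) = B(x, *_L (e y))`. [cite: Andre1996Motifs, Prop. 1.2 (p. 11) and its proof (p. 12)] -/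
theorem HasLefschetzProperty.isAdjointPair_compl₂_lefschetzInvolution' (L : HasLefschetzProperty h e) (hgr : IsZGrading h)
    (hh : B.IsSkewAdjoint h) (he : B.IsSelfAdjoint e) :
    LinearMap.IsAdjointPair (B.compl₂ (L.lefschetzInvolution hgr)) (B.compl₂ (L.lefschetzInvolution hgr))
      ⇑(L.lefschetzInvolution hgr * e * L.lefschetzInvolution hgr) ⇑e := by
  intro x y
  have hs := L.isSelfAdjoint_lefschetzInvolution hgr hh he
  rw [LinearMap.compl₂_apply, LinearMap.compl₂_apply, Module.End.mul_apply, Module.End.mul_apply, hs, he, hs,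
    L.lefschetzInvolution_lefschetzInvolution hgr]

/-- The same for `* = *_H`: `B(e x, *_H y) = B(x, *_H ((*_H e *_H) y))`. [cite: Andre1996Motifs, Prop. 1.2 (p. 11, "pour * = *_L ou *_H")] -/
theorem HasLefschetzProperty.isAdjointPair_compl₂_hodgeInvolution (L : HasLefschetzProperty h e) (hgr : IsZGrading h) (d : ℕ)
    (he : B.IsSelfAdjoint e) :
    LinearMap.IsAdjointPair (B.compl₂ (L.hodgeInvolution hgr d)) (B.compl₂ (L.hodgeInvolution hgr d)) ⇑e
      ⇑(L.hodgeInvolution hgr d * e * L.hodgeInvolution hgr d) := by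
  intro x y
  rw [LinearMap.compl₂_apply, LinearMap.compl₂_apply, he, Module.End.mul_apply, Module.End.mul_apply,
    L.hodgeInvolution_hodgeInvolution hgr d]

/-- … and `B((*_H e *_H) x, *_H y) = B(x, *_H (e y))`. [cite: Andre1996Motifs, Prop. 1.2 (p. 11, "pour * = *_L ou *_H")] -/
theorem HasLefschetzProperty.isAdjointPair_compl₂_hodgeInvolution' (L : HasLefschetzProperty h e) (hgr : IsZGrading h) (d : ℕ)
    (hh : B.IsSkewAdjoint h) (he : B.IsSelfAdjoint e) :
    LinearMap.IsAdjointPair (B.compl₂ (L.hodgeInvolution hgr d)) (B.compl₂ (L.hodgeInvolution hgr d))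
      ⇑(L.hodgeInvolution hgr d * e * L.hodgeInvolution hgr d) ⇑e := by
  intro x y
  have hs := L.isSelfAdjoint_hodgeInvolution hgr d hh he
  rw [LinearMap.compl₂_apply, LinearMap.compl₂_apply, Module.End.mul_apply, Module.End.mul_apply, hs, he, hs,
    L.hodgeInvolution_hodgeInvolution hgr d]

end SelfAdjoint

/-! ### §4 A subalgebra generated by self-adjoint operators is stable under transposition -/

omit [CharZero K] in
/-- **Generic**: if every generator in `S` is self-adjoint for `B`, every element of the subalgebra `K[S]` has an adjoint in `K[S]`
(adjoints of sums are sums, of products are products in the opposite order). [cite: Andre1996Motifs, Prop. 1.2 (p. 12, proof: "il suffit de la tester sur les générateurs")] -/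
theorem exists_isAdjointPair_of_mem_adjoin {S : Set (Module.End K M)} (hS : ∀ a ∈ S, B.IsSelfAdjoint a) {T : Module.End K M}
    (hT : T ∈ Algebra.adjoin K S) : ∃ T' ∈ Algebra.adjoin K S, LinearMap.IsAdjointPair B B T T' := by
  induction hT using Algebra.adjoin_induction with
  | mem a ha => exact ⟨a, Algebra.subset_adjoin ha, hS a ha⟩
  | algebraMap r =>
    refine ⟨algebraMap K (Module.End K M) r, Subalgebra.algebraMap_mem _ r, fun x y ↦ ?_⟩
    rw [Module.algebraMap_end_apply, Module.algebraMap_end_apply, map_smul, LinearMap.smul_apply, map_smul]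
  | add a b _ _ ha hb =>
    obtain ⟨a', ha', haa⟩ := ha
    obtain ⟨b', hb', hbb⟩ := hb
    exact ⟨a' + b', Subalgebra.add_mem _ ha' hb', haa.add hbb⟩
  | mul a b _ _ ha hb =>
    obtain ⟨a', ha', haa⟩ := ha
    obtain ⟨b', hb', hbb⟩ := hb
    exact ⟨b' * a', Subalgebra.mul_mem _ hb' ha', haa.mul hbb⟩

/-- **`K[L, ᶜΛ]` is stable under transposition for the Poincaré pairing** (`L` and `ᶜΛ` are self-adjoint). [cite: Andre1996Motifs, §1.1 (p. 11) and Prop. 1.2 (p. 11)] -/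
theorem HasLefschetzProperty.exists_isAdjointPair_of_mem_adjoin_pair_dual [FiniteDimensional K M] (L : HasLefschetzProperty h e)
    (hgr : IsZGrading h) (hh : B.IsSkewAdjoint h) (he : B.IsSelfAdjoint e) {T : Module.End K M}
    (hT : T ∈ Algebra.adjoin K ({e, L.dual hgr} : Set (Module.End K M))) :
    ∃ T' ∈ Algebra.adjoin K ({e, L.dual hgr} : Set (Module.End K M)), LinearMap.IsAdjointPair B B T T' := by
  refine exists_isAdjointPair_of_mem_adjoin ?_ hT
  rintro a (rfl | rfl)
  · exact he
  · exact L.isSelfAdjoint_dual hgr hh he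

/-- `K[L, *_L]` is stable under transposition as well. [cite: Andre1996Motifs, §1.1 (p. 11) and Prop. 1.2 (p. 11)] -/
theorem HasLefschetzProperty.exists_isAdjointPair_of_mem_adjoin_pair_lefschetzInvolution [FiniteDimensional K M]
    (L : HasLefschetzProperty h e) (hgr : IsZGrading h) (hh : B.IsSkewAdjoint h) (he : B.IsSelfAdjoint e) {T : Module.End K M}
    (hT : T ∈ Algebra.adjoin K ({e, L.lefschetzInvolution hgr} : Set (Module.End K M))) :
    ∃ T' ∈ Algebra.adjoin K ({e, L.lefschetzInvolution hgr} : Set (Module.End K M)), LinearMap.IsAdjointPair B B T T' := by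
  refine exists_isAdjointPair_of_mem_adjoin ?_ hT
  rintro a (rfl | rfl)
  · exact he
  · exact L.isSelfAdjoint_lefschetzInvolution hgr hh he

end Literature.Algebra.Lie

end
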